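import Summits.Ventures.PercRepro.K4Matroid
import Summits.Ventures.PercRepro.K4LadderArith

/-!
# PercRepro — C-025 on `T_p(M(K₄) ⊕ U_{m,m})`: the matroid bridge (p9, gen 14)

`proofs/P9-S4-LINELADDER-g13.md` §8 closed in the tree on the active layers: the block `M(K₄)` (`K4Matroid`) is
transported along any embedding `e : Fin 6 ↪ α` (`Matroid.mapEmbedding`), its profiles are those of `K4Matroid`
(`mapK4_eRk`, `mapK4_eRk_compl`), the base-layer inequalities of the meta-theorem `rls_blockFree_of_base` (BlockSum)
are the profile form of `K4LadderArith` (`k4_profile_ineq`: the levels `q ≥ 3` from `k4_ineq`, `q = 2, 1, 0` from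
`k4_two`, `k4_one`, `k4_zero`, and the corner `(2, 0)` by hand), and **`rls_k4Ladder`** is C-025 on
`T_p(M(K₄) ⊕ U_{m,m})` for every level `q`, every `p ≥ q + 2` and every `m ≥ p + q − 3` (every corank `≥ q + 3`).
Nothing here is about any window of S4.
-/

namespace PercRepro.K4Ladder

open Set Finset PercRepro.LineLadder

/-! ### The base-layer inequality in profile form, at every level -/

/-- The `U`-orbit sum of a profile `b = (k₁, k₂)` (the summand of `orbit_sum_U`). -/
def orbU (p q m : ℕ) (b : ℕ × ℕ) : ℕ :=
  ∑ a ∈ range (m + 1), if min p (b.1 + a) = p ∧ min p (b.2 + (m - a)) = q then m.choose a else 0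

/-- The `Y`-orbit sum of a profile `b = (k₁, k₂)` (the summand of `orbit_sum_Y`). -/
def orbY (p q m : ℕ) (b : ℕ × ℕ) : ℕ :=
  ∑ a ∈ range (m + 1), if q < min p (b.1 + a) ∧ min p (b.1 + a) < p then m.choose a else 0

/-- **The K₄ inequality in profile form** on the active layers (`m ≥ p + q − 3`), at every level `q`: the seven
orbit sums of `orbit_sum_U` / `orbit_sum_Y` with the multiplicities `1, 6, 19, 12, 19, 6, 1`. -/
theorem k4_profile_ineq (p q m : ℕ) (hpq : q + 2 ≤ p) (hm : p + q - 3 ≤ m) :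
    phiK p q * (((if 3 ≤ q then m.choose (q - 3) else 0) + 6 * (if 3 ≤ q then m.choose (q - 3) else 0)
        + 19 * (if 3 ≤ q then m.choose (q - 3) else 0) + 12 * (if 3 ≤ q then m.choose (q - 3) else 0)
        + 19 * (if 2 ≤ q then m.choose (q - 2) else 0) + 6 * (if 1 ≤ q then m.choose (q - 1) else 0)
        + (if 0 ≤ q then m.choose (q - 0) else 0) : ℕ) : ℚ)
      ≤ ((∑ a ∈ Ico (q + 1) p, m.choose a + 6 * ∑ a ∈ Ico q (p - 1), m.choose a
        + 19 * ∑ a ∈ Ico (q - 1) (p - 2), m.choose a + 12 * ∑ a ∈ Ico (q - 2) (p - 3), m.choose a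
        + 19 * ∑ a ∈ Ico (q - 2) (p - 3), m.choose a + 6 * ∑ a ∈ Ico (q - 2) (p - 3), m.choose a
        + ∑ a ∈ Ico (q - 2) (p - 3), m.choose a : ℕ) : ℚ) := by
  have foldU : ((if 3 ≤ q then m.choose (q - 3) else 0) + 6 * (if 3 ≤ q then m.choose (q - 3) else 0)
        + 19 * (if 3 ≤ q then m.choose (q - 3) else 0) + 12 * (if 3 ≤ q then m.choose (q - 3) else 0)
        + 19 * (if 2 ≤ q then m.choose (q - 2) else 0) + 6 * (if 1 ≤ q then m.choose (q - 1) else 0)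
        + (if 0 ≤ q then m.choose (q - 0) else 0) : ℕ)
      = 38 * (if 3 ≤ q then m.choose (q - 3) else 0) + 19 * (if 2 ≤ q then m.choose (q - 2) else 0)
        + 6 * (if 1 ≤ q then m.choose (q - 1) else 0) + m.choose q := by
    rw [if_pos (Nat.zero_le q), Nat.sub_zero]; ring
  have foldY : (∑ a ∈ Ico (q + 1) p, m.choose a + 6 * ∑ a ∈ Ico q (p - 1), m.choose a
        + 19 * ∑ a ∈ Ico (q - 1) (p - 2), m.choose a + 12 * ∑ a ∈ Ico (q - 2) (p - 3), m.choose a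
        + 19 * ∑ a ∈ Ico (q - 2) (p - 3), m.choose a + 6 * ∑ a ∈ Ico (q - 2) (p - 3), m.choose a
        + ∑ a ∈ Ico (q - 2) (p - 3), m.choose a : ℕ)
      = ∑ a ∈ Ico (q + 1) p, m.choose a + 6 * ∑ a ∈ Ico q (p - 1), m.choose a
        + 19 * ∑ a ∈ Ico (q - 1) (p - 2), m.choose a + 38 * ∑ a ∈ Ico (q - 2) (p - 3), m.choose a := by
    ring
  rw [foldU, foldY]
  rcases Nat.lt_or_ge q 3 with hq | hq
  · interval_cases q
    · -- level 0: `#U = 1`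
      rw [if_neg (by omega), if_neg (by omega), if_neg (by omega), Nat.choose_zero_right]
      rcases Nat.lt_or_ge p 3 with hp | hp
      · -- the corner `(p, q) = (2, 0)`: `Φ(2, 0) = 2 ≤ m + 6`
        obtain rfl : p = 2 := by omega
        rw [phiK_two_zero, show Finset.Ico (0 + 1) 2 = {1} by decide, show Finset.Ico 0 (2 - 1) = {0} by decide,
          show Finset.Ico (0 - 1) (2 - 2) = ∅ by decide]
        simp only [Finset.sum_singleton, Finset.sum_empty, Nat.choose_one_right, Nat.choose_zero_right]
        push_cast
        linarith [show (0 : ℚ) ≤ m from Nat.cast_nonneg m]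
      · obtain ⟨t, rfl⟩ : ∃ t, p = t + 3 := ⟨p - 3, by omega⟩
        have h := k4_zero t m (by omega)
        rw [show t + 3 - 1 = t + 2 by omega, show t + 3 - 2 = t + 1 by omega, show t + 3 - 3 = t by omega]
        simpa using h
    · -- level 1: `#U = 6 + m`
      obtain ⟨s, rfl⟩ : ∃ s, p = s + 3 := ⟨p - 3, by omega⟩
      have h := k4_one s m (by omega)
      rw [if_neg (by omega), if_neg (by omega), if_pos (le_refl 1)]
      simpa using h
    · -- level 2: `#U = 19 + 6m + C(m,2)`
      obtain ⟨s, rfl⟩ : ∃ s, p = s + 4 := ⟨p - 4, by omega⟩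
      have h := k4_two s m (by omega)
      rw [if_neg (by omega), if_pos (le_refl 2), if_pos (by omega)]
      simpa using h
  · -- levels `q ≥ 3`: `k4_ineq`
    rw [if_pos hq, if_pos (by omega), if_pos (by omega)]
    exact k4_ineq p q m hq hpq hm

/-! ### `M(K₄)` transported along an embedding -/

variable {α : Type}

/-- `M(K₄)` on any six points of `α` (along an embedding `e : Fin 6 ↪ α`) is finite. -/
theorem mapK4_finite (e : Fin 6 ↪ α) : (K4.mapEmbedding e).Finite :=
  ⟨by rw [Matroid.mapEmbedding_ground_eq]; exact Set.finite_univ.image _⟩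

/-- The ground set of the transported `M(K₄)` is the range of the embedding. -/
theorem mapK4_ground (e : Fin 6 ↪ α) : (K4.mapEmbedding e).E = Set.range e := by
  rw [Matroid.mapEmbedding_ground_eq, K4_ground, Set.image_univ]

/-- The rank function of the transported `M(K₄)` on the image of an edge set. -/
theorem mapK4_eRk (e : Fin 6 ↪ α) (X : Finset (Fin 6)) :
    (K4.mapEmbedding e).eRk (e '' (↑X : Set (Fin 6))) = (rk X : ℕ∞) := by
  rw [Matroid.mapEmbedding, Matroid.eRk_map K4 e.injective.injOn (Set.subset_univ _), eRk_coe]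

/-- The rank of the complement of the image of an edge set. -/
theorem mapK4_eRk_compl (e : Fin 6 ↪ α) (X : Finset (Fin 6)) :
    (K4.mapEmbedding e).eRk ((K4.mapEmbedding e).E \ e '' (↑X : Set (Fin 6))) = (rk Xᶜ : ℕ∞) := by
  rw [mapK4_ground, ← Set.image_univ, ← Set.image_sdiff e.injective, ← Set.compl_eq_univ_sdiff,
    ← Finset.coe_compl, mapK4_eRk]

/-- The subsets of the ground set of the transported `M(K₄)` are the images of the 64 edge sets. -/
theorem finite_subsets_eq (e : Fin 6 ↪ α) :
    (mapK4_finite e).ground_finite.finite_subsets.toFinset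
      = (univ : Finset (Finset (Fin 6))).image (fun X : Finset (Fin 6) => e '' (↑X : Set (Fin 6))) := by
  ext T
  rw [Set.Finite.mem_toFinset, Set.mem_setOf_eq, Finset.mem_image, mapK4_ground]
  constructor
  · intro hT
    refine ⟨(Set.toFinite (e ⁻¹' T)).toFinset, Finset.mem_univ _, ?_⟩
    rw [Set.Finite.coe_toFinset, Set.image_preimage_eq_of_subset hT]
  · rintro ⟨X, -, rfl⟩
    exact Set.image_subset_range _ _

/-- `X ↦ e '' ↑X` is injective on edge sets. -/
theorem image_coe_injective (e : Fin 6 ↪ α) :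
    Function.Injective (fun X : Finset (Fin 6) => e '' (↑X : Set (Fin 6))) := fun _ _ h =>
  Finset.coe_injective ((Set.image_injective.2 e.injective) h)

/-- **C-025 ON `T_p(M(K₄) ⊕ U_{m,m})` ON THE ACTIVE LAYERS** (P9-S4-LINELADDER-g13.md §8, both halves in the tree):
for `M(K₄)` on six points of `α` (`e : Fin 6 ↪ α`), `F` any finite set of `m` further points, every level `q`,
every rank `p ≥ q + 2` and every `m ≥ p + q − 3` (every corank `d = m + 6 − p ≥ q + 3`),
`Φ(p,q)·#U ≤ #Y` holds for `T_p(M(K₄) ⊕ U_{m,m})`. -/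
theorem rls_k4Ladder (e : Fin 6 ↪ α) {F : Set α} (hF : F.Finite)
    (hEF : Disjoint (K4.mapEmbedding e).E (Matroid.freeOn F).E) {m p q : ℕ} (hFm : F.ncard = m)
    (hpq : q + 2 ≤ p) (hm : p + q - 3 ≤ m) :
    @ThmN.RLS α (@PercRepro.Matroid.truncate α ((K4.mapEmbedding e).disjointSum (Matroid.freeOn F) hEF)
        (@blockFree_finite α _ (mapK4_finite e) F hF hEF) p)
      (@PercRepro.Matroid.truncate_finite α _ (@blockFree_finite α _ (mapK4_finite e) F hF hEF) p) p q := by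
  haveI := mapK4_finite e
  refine rls_blockFree_of_base (K4.mapEmbedding e) hF hEF p q (p + q - 3) hpq ?_ ?_ (by omega)
  · intro X hX
    rw [mapK4_ground] at hX
    obtain ⟨X', rfl⟩ : ∃ X' : Finset (Fin 6), e '' (↑X' : Set (Fin 6)) = X :=
      ⟨(Set.toFinite (e ⁻¹' X)).toFinset, by rw [Set.Finite.coe_toFinset, Set.image_preimage_eq_of_subset hX]⟩
    rw [mapK4_eRk, mapK4_eRk_compl]
    simp only [ENat.toNat_coe]
    have := three_le_rk_add_rk_compl X'
    omega
  · intro j hj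
    rw [finite_subsets_eq, Finset.sum_image (fun _ _ _ _ h => image_coe_injective e h),
      Finset.sum_image (fun _ _ _ _ h => image_coe_injective e h)]
    simp only [mapK4_eRk, mapK4_eRk_compl, ENat.toNat_coe]
    show phiK (p - j) (q - j) * ((∑ x : Finset (Fin 6), orbU (p - j) (q - j) (p + q - 3) (profile x) : ℕ) : ℚ)
      ≤ ((∑ x : Finset (Fin 6), orbY (p - j) (q - j) (p + q - 3) (profile x) : ℕ) : ℚ)
    rw [sum_profile (orbU (p - j) (q - j) (p + q - 3)), sum_profile (orbY (p - j) (q - j) (p + q - 3))]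
    simp only [orbU, orbY]
    have hqp : q - j < p - j := by omega
    rw [orbit_sum_U (p - j) (q - j) (p + q - 3) 0 3 hqp (by omega),
      orbit_sum_U (p - j) (q - j) (p + q - 3) 1 3 hqp (by omega),
      orbit_sum_U (p - j) (q - j) (p + q - 3) 2 3 hqp (by omega),
      orbit_sum_U (p - j) (q - j) (p + q - 3) 3 3 hqp (by omega),
      orbit_sum_U (p - j) (q - j) (p + q - 3) 3 2 hqp (by omega),
      orbit_sum_U (p - j) (q - j) (p + q - 3) 3 1 hqp (by omega),
      orbit_sum_U (p - j) (q - j) (p + q - 3) 3 0 hqp (by omega),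
      orbit_sum_Y (p - j) (q - j) (p + q - 3) 0, orbit_sum_Y (p - j) (q - j) (p + q - 3) 1,
      orbit_sum_Y (p - j) (q - j) (p + q - 3) 2, orbit_sum_Y (p - j) (q - j) (p + q - 3) 3]
    rw [show q - j + 1 - 0 = q - j + 1 by omega, show p - j - 0 = p - j by omega,
      show q - j + 1 - 1 = q - j by omega, show q - j + 1 - 2 = q - j - 1 by omega,
      show q - j + 1 - 3 = q - j - 2 by omega]
    exact k4_profile_ineq (p - j) (q - j) (p + q - 3) (by omega) (by omega)

end PercRepro.K4Ladder
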